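import Summits.QuantumAdvantage.QuantumAdvantage.Theorems.LinnikCubicClassGroupsPureCubicClassGroupFBQPStubCubicFilteredCycle
import Literature.NumberTheory.CubicFields.VoronoiCylinderStep
import Literature.NumberTheory.CubicFields.PeriodicChainCells
import Literature.NumberTheory.CubicFields.PureCubicIdealCodes

/-!
# Crux `LinnikCubicClassGroups.PureCubicClassGroupFBQP` (stmt-QuantumAdvantage-11544) — stub `stub_classTableSem`, part CIRCLE

Line `arakelov-giant-step-cycle`, stub `stub_classTableSem` (S5b-P5b), FIRST PART: the CIRCLE OF REDUCED IDEALS of an ideal class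
of the pure cubic field `ℚ(θ)`, `θ³ = ab²`, packaged for the structural interface of the class table. For a nonzero fractional
ideal `A` with a positive relative minimum `x₀` and the Voronoi chain `θ(i)` through it:

* `circle_label_eq_iff` — the canonical codes of the reduced ideals `θ(i)⁻¹ A` repeat EXACTLY with the period `n₀` of the
  chain under the regulator unit (`θ(j) = u θ(i)` for a positive unit `u = ε^q`, so `j = i + q n₀`);
* `circle_package` — the whole package: period `n₀ ≥ 1` with `n₀ log 2 ≤ 6 R_K`, logarithms `G(i) = log σ₁θ(i)` strictly
  increasing with `G(i + n₀) = G(i) + R_K` and gaps `≤ log(3√|d_K|)`, an index function of the cells of `G`, canonical codes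
  of the reduced labels with the exact-period property, and the six-gap through every base point.
-/

set_option linter.dupNamespace false

namespace Summit.QuantumAdvantage.QuantumAdvantage.Theorems.LinnikCubicClassGroups

open scoped NumberField nonZeroDivisors
open NumberField
open Literature.NumberTheory.CubicFields
open Literature.NumberTheory.CubicFields.PureCubicCodes (Canon Mem)

section Circle

variable {K : Type} [Field K] [NumberField K] {a b : ℕ} {θ : K} {σ₁ : K →+* ℝ} {σ₂ : K →+* ℂ}
variable (hdeg : Module.finrank ℚ K = 3) (hσ₂ : ∃ z : K, starRingEnd ℂ (σ₂ z) ≠ σ₂ z)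
  (hab : Squarefree (a * b)) (hab1 : a * b ≠ 1) (hθ : θ ^ 3 = ((a * b ^ 2 : ℕ) : K))

omit [NumberField K] in
/-- Fractional ideals with the same elements are equal. -/
theorem fractionalIdeal_eq_of_mem_iff {I J : FractionalIdeal (𝓞 K)⁰ K} (h : ∀ φ : K, φ ∈ I ↔ φ ∈ J) : I = J :=
  FractionalIdeal.ext h

include hdeg hσ₂ hab hab1 hθ in
/-- **Exact period of the reduced labels.** With `θ = voronoiChain A x₀`, `θ(i + n₀) = ε θ(i)` for the regulator unit `ε`
(`log σ₁ ε = R_K`, `σ₁ ε > 1`) and canonical codes `Lab i` of `θ(i)⁻¹ A`: `Lab i = Lab j ↔ n₀ ∣ i − j`. -/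
theorem circle_label_eq_iff {A : FractionalIdeal (𝓞 K)⁰ K} (hA : A ≠ 0) {x₀ : K} (hx₀ : x₀ ∈ posRelMinima σ₁ σ₂ A)
    {ε : (𝓞 K)ˣ} (hε : 1 < σ₁ (algebraMap (𝓞 K) K ε)) (hreg : Real.log (σ₁ (algebraMap (𝓞 K) K ε)) = Units.regulator K)
    {n₀ : ℕ}
    (hper : ∀ i, voronoiChain σ₁ σ₂ A x₀ (i + n₀) = algebraMap (𝓞 K) K ε * voronoiChain σ₁ σ₂ A x₀ i)
    {Lab : ℤ → ℕ × List ℤ} (hLab : ∀ i, Canon (Lab i) ∧ ∀ φ : K, Mem θ b (Lab i) φ ↔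
      φ ∈ FractionalIdeal.spanSingleton (𝓞 K)⁰ (voronoiChain σ₁ σ₂ A x₀ i)⁻¹ * A) (i j : ℤ) :
    Lab i = Lab j ↔ (n₀ : ℤ) ∣ i - j := by
  have hε0 : 0 < σ₁ (algebraMap (𝓞 K) K ε) := by linarith
  have hεne : algebraMap (𝓞 K) K ε ≠ 0 := (map_ne_zero σ₁).mp hε0.ne'
  have hmem := fun k => voronoiChain_mem hdeg hσ₂ ε hε hx₀ k
  have hmono := voronoiChain_strictMono hdeg hσ₂ ε hε hx₀
  have hind := fun c₀ c₁ c₂ h => Literature.NumberTheory.NumberFields.PureCubic.coords_eq_zero (K := K) hdeg hab hab1 hθ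
    (c₀ := c₀) (c₁ := c₁) (c₂ := c₂) h
  constructor
  · intro h
    -- equal codes ⇒ equal ideals ⇒ generators differ by a positive unit `ε^q`
    have hIJ : FractionalIdeal.spanSingleton (𝓞 K)⁰ (voronoiChain σ₁ σ₂ A x₀ i)⁻¹ * A =
        FractionalIdeal.spanSingleton (𝓞 K)⁰ (voronoiChain σ₁ σ₂ A x₀ j)⁻¹ * A :=
      fractionalIdeal_eq_of_mem_iff fun φ => by rw [← (hLab i).2 φ, ← (hLab j).2 φ, h]
    obtain ⟨u, hu⟩ := (spanSingleton_inv_mul_eq_iff hA (hmem j).1.2.1).mp hIJ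
    have hupos : 0 < σ₁ (algebraMap (𝓞 K) K u) := by
      have h1 := (hmem j).2
      rw [hu, map_mul] at h1
      exact (mul_pos_iff_of_pos_right (hmem i).2).mp h1
    obtain ⟨q, hq⟩ := unit_eq_zpow_of_pos hdeg σ₁ σ₂ hσ₂ hε hreg u hupos
    have e1 : voronoiChain σ₁ σ₂ A x₀ j = voronoiChain σ₁ σ₂ A x₀ (i + q * n₀) := by
      rw [voronoiChain_add_int_mul hεne hper, ← hq, ← hu]
    have e2 : j = i + q * n₀ := hmono.injective (congrArg σ₁ e1)
    exact ⟨-q, by rw [e2]; ring⟩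
  · rintro ⟨q, hq⟩
    have e : i = j + q * n₀ := by linarith
    apply PureCubicCodes.canon_unique θ b hind _ _ (hLab i).1 (hLab j).1
    intro φ
    rw [(hLab i).2 φ, (hLab j).2 φ, e, voronoiChain_label_periodic hdeg hσ₂ ε hε hx₀ ε hper]

include hdeg hσ₂ hab hab1 hθ in
/-- **The circle package of an ideal class.** For a nonzero fractional ideal `A` of the pure cubic field there are: a base
minimum `x₀`, a period `n₀ ≥ 1` (`n₀ log 2 ≤ 6 R_K`) with `log σ₁θ(i + n₀) = log σ₁θ(i) + R_K` along the chain `θ` through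
`x₀` (strictly increasing logarithms, gaps `≤ log(3√|d_K|)`), an index function of its cells, canonical codes of the reduced
labels `θ(i)⁻¹ A` repeating exactly with period `n₀`, and the six-gap through every positive minimum of `A`. -/
theorem circle_package (A : FractionalIdeal (𝓞 K)⁰ K) (hA : A ≠ 0) :
    ∃ (x₀ : K) (n₀ : ℕ) (idx : ℝ → ℤ) (Lab : ℤ → ℕ × List ℤ) (ε : (𝓞 K)ˣ),
      x₀ ∈ posRelMinima σ₁ σ₂ A ∧ 0 < n₀ ∧ (n₀ : ℝ) * Real.log 2 ≤ 6 * Units.regulator K ∧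
      1 < σ₁ (algebraMap (𝓞 K) K ε) ∧ Real.log (σ₁ (algebraMap (𝓞 K) K ε)) = Units.regulator K ∧
      (∀ i, voronoiChain σ₁ σ₂ A x₀ (i + n₀) = algebraMap (𝓞 K) K ε * voronoiChain σ₁ σ₂ A x₀ i) ∧
      StrictMono (fun i => Real.log (σ₁ (voronoiChain σ₁ σ₂ A x₀ i))) ∧
      (∀ i, Real.log (σ₁ (voronoiChain σ₁ σ₂ A x₀ (i + n₀))) = Real.log (σ₁ (voronoiChain σ₁ σ₂ A x₀ i)) + Units.regulator K) ∧
      (∀ i, Real.log (σ₁ (voronoiChain σ₁ σ₂ A x₀ (i + 1))) - Real.log (σ₁ (voronoiChain σ₁ σ₂ A x₀ i)) ≤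
        Real.log (3 * Real.sqrt |(discr K : ℝ)|)) ∧
      (∀ i, 0 < σ₁ (voronoiChain σ₁ σ₂ A x₀ i)) ∧
      (∀ x, Real.log (σ₁ (voronoiChain σ₁ σ₂ A x₀ (idx x))) ≤ x ∧ x < Real.log (σ₁ (voronoiChain σ₁ σ₂ A x₀ (idx x + 1)))) ∧
      (∀ i, Canon (Lab i) ∧ ∀ φ : K, Mem θ b (Lab i) φ ↔
        φ ∈ FractionalIdeal.spanSingleton (𝓞 K)⁰ (voronoiChain σ₁ σ₂ A x₀ i)⁻¹ * A) ∧
      (∀ i j, Lab i = Lab j ↔ (n₀ : ℤ) ∣ i - j) ∧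
      (∀ i, (1 : K) ∈ posRelMinima σ₁ σ₂ (FractionalIdeal.spanSingleton (𝓞 K)⁰ (voronoiChain σ₁ σ₂ A x₀ i)⁻¹ * A)) ∧
      (∀ x₀' ∈ posRelMinima σ₁ σ₂ A, ∀ i,
        2 * σ₁ (voronoiChain σ₁ σ₂ A x₀' i) ≤ σ₁ (voronoiChain σ₁ σ₂ A x₀' (i + 6))) := by
  classical
  obtain ⟨x₀, hx₀⟩ := posRelMinima_nonempty (σ₁ := σ₁) hdeg hσ₂ hA
  obtain ⟨s, n₀, nS, ε, hn₀, hε, hreg, hper, h6R, -, -, -, -, -, -, -, -, -, -, hone, -, -⟩ :=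
    stub_cubicFilteredCycle K hdeg σ₁ σ₂ hσ₂ A hA x₀ hx₀
  have hε' : 1 < σ₁ (algebraMap (𝓞 K) K ε) := hε
  have hε0 : 0 < σ₁ (algebraMap (𝓞 K) K ε) := by linarith
  have hreg' : Real.log (σ₁ (algebraMap (𝓞 K) K ε)) = Units.regulator K := hreg
  have hper' : ∀ i, voronoiChain σ₁ σ₂ A x₀ (i + n₀) = algebraMap (𝓞 K) K ε * voronoiChain σ₁ σ₂ A x₀ i := hper
  have hmem := fun i => voronoiChain_mem hdeg hσ₂ ε hε' hx₀ i
  have hpos : ∀ i, 0 < σ₁ (voronoiChain σ₁ σ₂ A x₀ i) := fun i => (hmem i).2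
  have hmono : StrictMono (fun i => Real.log (σ₁ (voronoiChain σ₁ σ₂ A x₀ i))) := fun i j hij =>
    Real.log_lt_log (hpos i) (voronoiChain_strictMono hdeg hσ₂ ε hε' hx₀ hij)
  have hperlog : ∀ i, Real.log (σ₁ (voronoiChain σ₁ σ₂ A x₀ (i + n₀))) =
      Real.log (σ₁ (voronoiChain σ₁ σ₂ A x₀ i)) + Units.regulator K := fun i => by
    rw [hper', map_mul, Real.log_mul hε0.ne' (hpos i).ne', hreg']; ring
  obtain ⟨idx, hidx⟩ := chain_exists_indexFn hmono hn₀ hperlog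
  -- canonical codes of the reduced labels
  have hlab : ∀ i : ℤ, ∃ c : ℕ × List ℤ, Canon c ∧ ∀ φ : K, Mem θ b c φ ↔
      φ ∈ FractionalIdeal.spanSingleton (𝓞 K)⁰ (voronoiChain σ₁ σ₂ A x₀ i)⁻¹ * A := fun i => by
    refine exists_canon_code hdeg hab hab1 hθ _ ?_
    refine mul_ne_zero ?_ hA
    rw [Ne, FractionalIdeal.spanSingleton_eq_zero_iff]
    exact inv_ne_zero (hmem i).1.2.1
  choose Lab hLab using hlab
  refine ⟨x₀, n₀, idx, Lab, ε, hx₀, hn₀, h6R, hε', hreg', hper', hmono, hperlog, fun i => ?_, hpos, hidx, hLab,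
    fun i j => circle_label_eq_iff hdeg hσ₂ hab hab1 hθ hA hx₀ hε' hreg' hper' hLab i j,
    fun i => one_mem_posRelMinima_inv_mul (hmem i),
    fun x₀' hx₀' i => voronoiChain_six_gap hdeg hσ₂ ε hε' stub_packing hx₀' i⟩
  have h := log_voronoiChain_add_natCast_le hdeg hσ₂ ε hε' hx₀ i 1
  simp only [Nat.cast_one, one_mul] at h
  linarith

end Circle

/-- **P5b helper `classTableSem_circle_package`** (registered): the circle package of an ideal class of the pure cubic field. -/
theorem classTableSem_circle_package : ∀ (a b : ℕ), Squarefree (a * b) → a * b ≠ 1 → ∀ (K : Type) [Field K] [NumberField K], Module.finrank ℚ K = 3 → ∀ θ : K, θ ^ 3 = ((a * b ^ 2 : ℕ) : K) → ∀ (σ₁ : K →+* ℝ) (σ₂ : K →+* ℂ), (∃ z : K, starRingEnd ℂ (σ₂ z) ≠ σ₂ z) → ∀ (A : FractionalIdeal (𝓞 K)⁰ K), A ≠ 0 → ∃ (x₀ : K) (n₀ : ℕ) (idx : ℝ → ℤ) (Lab : ℤ → ℕ × List ℤ) (ε : (𝓞 K)ˣ), x₀ ∈ posRelMinima σ₁ σ₂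 A ∧ 0 < n₀ ∧ (n₀ : ℝ) * Real.log 2 ≤ 6 * NumberField.Units.regulator K ∧ 1 < σ₁ (algebraMap (𝓞 K) K ε) ∧ Real.log (σ₁ (algebraMap (𝓞 K) K ε)) = NumberField.Units.regulator K ∧ (∀ i, voronoiChain σ₁ σ₂ A x₀ (i + n₀) = algebraMap (𝓞 K) K ε * voronoiChain σ₁ σ₂ A x₀ i) ∧ StrictMono (fun i => Real.log (σ₁ (voronoiChain σ₁ σ₂ A x₀ i))) ∧ (∀ i, Real.log (σ₁ (voronoiChain σ₁ σ₂ A x₀ (i + n₀))) = Real.log (σ₁ (voronoiChain σ₁ σ₂ A x₀ i)) + NumberField.Units.regulator K) ∧ (∀ i, Real.log (σ₁ (voronoiChain σ₁ σ₂ A x₀ (i + 1))) - Real.log (σ₁ (voronoiChain σ₁ σ₂ A x₀ i)) ≤ Real.log (3 * Real.sqrt |(NumberField.discr K : ℝ)|)) ∧ (∀ i, 0 < σ₁ (voronoiChain σ₁ σ₂ A x₀ i)) ∧ (∀ x, Real.log (σ₁ (voronoiChain σ₁ σ₂ A x₀ (idx x))) ≤ x ∧ x < Real.log (σ₁ (voronoiChain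 σ₁ σ₂ A x₀ (idx x + 1)))) ∧ (∀ i, PureCubicCodes.Canon (Lab i) ∧ ∀ φ : K, PureCubicCodes.Mem θ b (Lab i) φ ↔ φ ∈ FractionalIdeal.spanSingleton (𝓞 K)⁰ (voronoiChain σ₁ σ₂ A x₀ i)⁻¹ * A) ∧ (∀ i j, Lab i = Lab j ↔ (n₀ : ℤ) ∣ i - j) ∧ (∀ i, (1 : K) ∈ posRelMinima σ₁ σ₂ (FractionalIdeal.spanSingleton (𝓞 K)⁰ (voronoiChain σ₁ σ₂ A x₀ i)⁻¹ * A)) ∧ (∀ x₀' ∈ posRelMinima σ₁ σ₂ A, ∀ i, 2 * σ₁ (voronoiChain σ₁ σ₂ A x₀' i) ≤ σ₁ (voronoiChain σ₁ σ₂ A x₀' (i + 6))) :=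
  fun _ _ hab hab1 _ _ _ hdeg _ hθ _ _ hσ₂ A hA => circle_package hdeg hσ₂ hab hab1 hθ A hA


end Summit.QuantumAdvantage.QuantumAdvantage.Theorems.LinnikCubicClassGroups
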